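import Summits.Ventures.PackingBounds.Configurations.E8Design

/-!
# Design moments of `240`-point kissing configurations in `ℝ⁸` about EXTERNAL directions

Framing: lottery ticket; floor = certified bounds/negative ranges. Venture `PackingBounds` (cell
`pub-packcert`, seat `pub-packcert-energy`).

Let `C ⊂ S⁷` be any kissing configuration with `|C| = 240`. Complementary slackness
(`Kissing.kissing_dim8_moments_of_card_eq_240`) kills the TOTAL Gegenbauer moments
`Σ_{x,y ∈ C} C_k^{(3)}(⟨x,y⟩)`, `k = 1,…,6`. Bordering the positive semidefinite Gegenbauer matrix of
`C ∪ {u}` by an arbitrary unit vector `u` (not necessarily in `C`) shows that the moments vanish about every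
direction: `Σ_{y ∈ C} C_k^{(3)}(⟨u,y⟩) = 0` (`extMoment_eq_zero`), i.e. `C` is a spherical `6`-design in the
averaging sense. Consequences used by the uniqueness proof (`E8Frame.lean`):

* power sums `Σ_y ⟨u,y⟩² = 30‖u‖²`, `Σ_y ⟨u,y⟩⁴ = 9‖u‖⁴`, `Σ_y ⟨u,y⟩⁶ = (15/4)‖u‖⁶` for every `u ∈ ℝ⁸`;
* polarised mixed moments for orthonormal `u, v, w`:
  `Σ_y ⟨u,y⟩²⟨v,y⟩² = 3`, `Σ_y ⟨u,y⟩⁴⟨v,y⟩² = 3/4`, `Σ_y ⟨u,y⟩²⟨v,y⟩²⟨w,y⟩² = 1/4`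
  (the values of the corresponding monomial integrals over `S⁷` times `240`).

## References
* P. Delsarte, J.-M. Goethals, J. J. Seidel, *Spherical codes and designs*, Geom. Dedicata 6 (1977) 363–388, §§4–5.
* E. Bannai, N. J. A. Sloane, Canad. J. Math. 33 (1981) 437–449 (= Conway–Sloane, *SPLAG*, Ch. 14, Thm. 5). [`ConwaySloane1999`]
-/

namespace Summit.Ventures.PackingBounds.Config.E8Moments

open Finset Literature.Analysis.SpecialFunctions Literature.Geometry.DiscreteGeometry

/-- **Bordered positive semidefinite matrices**: if `M` (indexed by `Option ι`) is symmetric positive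
semidefinite and the principal block on `ι` has total sum `0`, then the border row sums to `0` against the
block: `Σ_{b ∈ ι} M(none, b) = 0`. -/
theorem crossSum_eq_zero_of_psd {ι : Type*} [Fintype ι] (M : Option ι → Option ι → ℝ)
    (hsym : ∀ a b, M a b = M b a) (hpsd : ∀ c : Option ι → ℝ, 0 ≤ ∑ a, ∑ b, c a * c b * M a b)
    (h0 : ∑ a : ι, ∑ b : ι, M (some a) (some b) = 0) : ∑ b : ι, M none (some b) = 0 := by
  apply DesignSlackness.eq_zero_of_quadratic_nonneg (G := M none none)
  intro t
  have hq := hpsd fun o => Option.elim o t fun _ => 1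
  have hcol : ∑ a : ι, M (some a) none = ∑ b : ι, M none (some b) :=
    Finset.sum_congr rfl fun a _ => hsym _ _
  rw [Fintype.sum_option] at hq
  simp only [Fintype.sum_option, Option.elim, mul_one, one_mul] at hq
  rw [← Finset.mul_sum, Finset.sum_add_distrib, ← Finset.mul_sum, hcol, h0] at hq
  have e : (2 * ∑ b, M none (some b)) * t + M none none * t ^ 2 =
      t * t * M none none + t * ∑ b, M none (some b) + (t * ∑ b, M none (some b) + 0) := by ring
  rw [e]; exact hq

section config

variable {C : Finset (EuclideanSpace ℝ (Fin 8))} (h1 : ∀ x ∈ C, ‖x‖ = 1)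
  (h2 : ∀ x ∈ C, ∀ y ∈ C, x ≠ y → inner ℝ x y ≤ 1 / 2) (hcard : C.card = 240)
include h1 h2 hcard

/-- **External design moments**: for every unit vector `u ∈ ℝ⁸` (in `C` or not) and `1 ≤ k ≤ 6`,
`Σ_{y ∈ C} C_k^{(3)}(⟨u, y⟩) = 0`. [cite: ConwaySloane1999, Ch. 14 Thm. 5] -/
theorem extMoment_eq_zero {u : EuclideanSpace ℝ (Fin 8)} (hu : ‖u‖ = 1) {k : ℕ} (hk1 : 1 ≤ k)
    (hk2 : k ≤ 6) : ∑ y ∈ C, gegenbauerSum (3 : ℝ) k (inner ℝ u y) = 0 := by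
  classical
  have htot := Kissing.kissing_dim8_moments_of_card_eq_240 C h1 h2 hcard hk1 hk2
  set v : Option C → EuclideanSpace ℝ (Fin 8) :=
    fun o => Option.elim o u fun a => (a : EuclideanSpace ℝ (Fin 8)) with hv
  have hM := crossSum_eq_zero_of_psd (ι := C)
    (fun a b => gegenbauerSum (3 : ℝ) k (inner ℝ (v a) (v b)))
    (fun a b => by simp only [real_inner_comm]) ?_ ?_
  · have h' : ∑ b : C, gegenbauerSum (3 : ℝ) k (inner ℝ u (b : EuclideanSpace ℝ (Fin 8))) = 0 := by
      simpa only [hv, Option.elim] using hM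
    rw [← Finset.sum_coe_sort C]
    exact h'
  · intro c
    have hpos := sum_mul_gegenbauerHom_nonneg (n := 8) (μ := 3) (by norm_num) (by norm_num) k
      (fun a : Option C => fun j => v a j) c
    have hunit : ∀ a : Option C, ∑ j, v a j ^ 2 = 1 := by
      intro a
      rw [← EuclideanSpace.real_norm_sq_eq]
      cases a with
      | none => simp only [hv, Option.elim, hu, one_pow]
      | some a => simp only [hv, Option.elim, h1 a a.2, one_pow]
    have hinner : ∀ a b : Option C, inner ℝ (v a) (v b) = ∑ j, v a j * v b j := fun a b => by
      simp [PiLp.inner_apply, mul_comm]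
    simp only [hunit, mul_one] at hpos
    simpa only [hinner, gegenbauerSum_eq_gegenbauerHom] using hpos
  · have h' : ∑ a : C, ∑ b : C, gegenbauerSum (3 : ℝ) k
        (inner ℝ (a : EuclideanSpace ℝ (Fin 8)) (b : EuclideanSpace ℝ (Fin 8))) = 0 := by
      rw [← Finset.sum_coe_sort C] at htot
      simp_rw [← Finset.sum_coe_sort C] at htot
      exact htot
    simpa only [hv, Option.elim] using h'

omit h1 h2 hcard in
/-- `C_4^{(3)}` explicitly. -/
private theorem geg3_4 (t : ℝ) : gegenbauerSum (3 : ℝ) 4 t = 240 * t ^ 4 - 120 * t ^ 2 + 6 := by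
  simp [gegenbauerSum, gegenbauerCoeff, Finset.sum_range_succ, Finset.prod_range_succ, Nat.factorial]
  ring

omit h1 h2 hcard in
/-- `C_6^{(3)}` explicitly. -/
private theorem geg3_6 (t : ℝ) :
    gegenbauerSum (3 : ℝ) 6 t = 1792 * t ^ 6 - 1680 * t ^ 4 + 360 * t ^ 2 - 10 := by
  simp [gegenbauerSum, gegenbauerCoeff, Finset.sum_range_succ, Finset.prod_range_succ, Nat.factorial]
  ring

/-- `Σ_{y ∈ C} ⟨u, y⟩² = 30` for a unit vector `u`. -/
theorem sum_inner_sq_unit {u : EuclideanSpace ℝ (Fin 8)} (hu : ‖u‖ = 1) :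
    ∑ y ∈ C, inner ℝ u y ^ 2 = 30 := by
  have h := extMoment_eq_zero h1 h2 hcard hu (k := 2) (by norm_num) (by norm_num)
  simp only [E8Design.gegenbauerSum_3_2, Finset.sum_sub_distrib, ← Finset.mul_sum, Finset.sum_const,
    hcard, nsmul_eq_mul] at h
  norm_num at h
  linarith

/-- `Σ_{y ∈ C} ⟨u, y⟩⁴ = 9` for a unit vector `u`. -/
theorem sum_inner_pow_four_unit {u : EuclideanSpace ℝ (Fin 8)} (hu : ‖u‖ = 1) :
    ∑ y ∈ C, inner ℝ u y ^ 4 = 9 := by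
  have h := extMoment_eq_zero h1 h2 hcard hu (k := 4) (by norm_num) (by norm_num)
  have hs := sum_inner_sq_unit h1 h2 hcard hu
  simp only [geg3_4, Finset.sum_add_distrib, Finset.sum_sub_distrib, ← Finset.mul_sum, Finset.sum_const,
    hcard, nsmul_eq_mul] at h
  rw [hs] at h
  norm_num at h
  linarith

/-- `Σ_{y ∈ C} ⟨u, y⟩⁶ = 15/4` for a unit vector `u`. -/
theorem sum_inner_pow_six_unit {u : EuclideanSpace ℝ (Fin 8)} (hu : ‖u‖ = 1) :
    ∑ y ∈ C, inner ℝ u y ^ 6 = 15 / 4 := by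
  have h := extMoment_eq_zero h1 h2 hcard hu (k := 6) (by norm_num) (by norm_num)
  have hs := sum_inner_sq_unit h1 h2 hcard hu
  have hf := sum_inner_pow_four_unit h1 h2 hcard hu
  simp only [geg3_6, Finset.sum_add_distrib, Finset.sum_sub_distrib, ← Finset.mul_sum, Finset.sum_const,
    hcard, nsmul_eq_mul] at h
  rw [hs, hf] at h
  norm_num at h
  linarith

/-- Homogeneous form: `Σ_{y ∈ C} ⟨u, y⟩⁴ = 9 ‖u‖⁴` for every `u`. -/
theorem sum_inner_pow_four (u : EuclideanSpace ℝ (Fin 8)) :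
    ∑ y ∈ C, inner ℝ u y ^ 4 = 9 * ‖u‖ ^ 4 := by
  by_cases hu : u = 0
  · subst hu; simp
  · have hn : ‖u‖ ≠ 0 := norm_ne_zero_iff.mpr hu
    have hunit : ‖(‖u‖⁻¹ : ℝ) • u‖ = 1 := by
      rw [norm_smul, norm_inv, norm_norm, inv_mul_cancel₀ hn]
    have h := sum_inner_pow_four_unit h1 h2 hcard hunit
    simp only [inner_smul_left, RCLike.conj_to_real, mul_pow, ← Finset.mul_sum] at h
    have h4 : ‖u‖⁻¹ ^ 4 * ‖u‖ ^ 4 = 1 := by rw [← mul_pow, inv_mul_cancel₀ hn, one_pow]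
    calc ∑ y ∈ C, inner ℝ u y ^ 4 = (‖u‖⁻¹ ^ 4 * ‖u‖ ^ 4) * ∑ y ∈ C, inner ℝ u y ^ 4 := by
          rw [h4, one_mul]
      _ = 9 * ‖u‖ ^ 4 := by rw [mul_comm (‖u‖⁻¹ ^ 4), mul_assoc, h, mul_comm]

/-- Homogeneous form: `Σ_{y ∈ C} ⟨u, y⟩⁶ = (15/4) ‖u‖⁶` for every `u`. -/
theorem sum_inner_pow_six (u : EuclideanSpace ℝ (Fin 8)) :
    ∑ y ∈ C, inner ℝ u y ^ 6 = 15 / 4 * ‖u‖ ^ 6 := by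
  by_cases hu : u = 0
  · subst hu; simp
  · have hn : ‖u‖ ≠ 0 := norm_ne_zero_iff.mpr hu
    have hunit : ‖(‖u‖⁻¹ : ℝ) • u‖ = 1 := by
      rw [norm_smul, norm_inv, norm_norm, inv_mul_cancel₀ hn]
    have h := sum_inner_pow_six_unit h1 h2 hcard hunit
    simp only [inner_smul_left, RCLike.conj_to_real, mul_pow, ← Finset.mul_sum] at h
    have h6 : ‖u‖⁻¹ ^ 6 * ‖u‖ ^ 6 = 1 := by rw [← mul_pow, inv_mul_cancel₀ hn, one_pow]
    calc ∑ y ∈ C, inner ℝ u y ^ 6 = (‖u‖⁻¹ ^ 6 * ‖u‖ ^ 6) * ∑ y ∈ C, inner ℝ u y ^ 6 := by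
          rw [h6, one_mul]
      _ = 15 / 4 * ‖u‖ ^ 6 := by rw [mul_comm (‖u‖⁻¹ ^ 6), mul_assoc, h, mul_comm]

/-- **Polarised fourth moment**: `Σ_{y ∈ C} ⟨u,y⟩²⟨v,y⟩² = 3` for orthonormal `u, v`
(`= 240 · ∫_{S⁷} x₁²x₂²`). -/
theorem sum_sq_mul_sq {u v : EuclideanSpace ℝ (Fin 8)} (hu : ‖u‖ = 1) (hv : ‖v‖ = 1)
    (huv : inner ℝ u v = 0) :
    ∑ y ∈ C, inner ℝ u y ^ 2 * inner ℝ v y ^ 2 = 3 := by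
  have hp := sum_inner_pow_four h1 h2 hcard (u + v)
  have hm := sum_inner_pow_four h1 h2 hcard (u - v)
  have h4u := sum_inner_pow_four_unit h1 h2 hcard hu
  have h4v := sum_inner_pow_four_unit h1 h2 hcard hv
  have hnp : ‖u + v‖ ^ 4 = 4 := by
    have : ‖u + v‖ ^ 2 = 2 := by rw [norm_add_sq_real, hu, hv, huv]; norm_num
    nlinarith [this]
  have hnm : ‖u - v‖ ^ 4 = 4 := by
    have : ‖u - v‖ ^ 2 = 2 := by rw [norm_sub_sq_real, hu, hv, huv]; norm_num
    nlinarith [this]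
  rw [hnp] at hp
  rw [hnm] at hm
  simp only [inner_add_left, inner_sub_left] at hp hm
  have key : ∑ y ∈ C, ((inner ℝ u y + inner ℝ v y) ^ 4 + (inner ℝ u y - inner ℝ v y) ^ 4) =
      ∑ y ∈ C, (2 * inner ℝ u y ^ 4 + 12 * (inner ℝ u y ^ 2 * inner ℝ v y ^ 2) + 2 * inner ℝ v y ^ 4) :=
    Finset.sum_congr rfl fun y _ => by ring
  rw [Finset.sum_add_distrib, hp, hm] at key
  simp only [Finset.sum_add_distrib, ← Finset.mul_sum, h4u, h4v] at key
  linarith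

/-- **Polarised sixth moment**: `Σ_{y ∈ C} ⟨u,y⟩⁴⟨v,y⟩² = 3/4` for orthonormal `u, v`. -/
theorem sum_pow_four_mul_sq {u v : EuclideanSpace ℝ (Fin 8)} (hu : ‖u‖ = 1) (hv : ‖v‖ = 1)
    (huv : inner ℝ u v = 0) :
    ∑ y ∈ C, inner ℝ u y ^ 4 * inner ℝ v y ^ 2 = 3 / 4 := by
  have hp := sum_inner_pow_six h1 h2 hcard (u + v)
  have hm := sum_inner_pow_six h1 h2 hcard (u - v)
  have hp2 := sum_inner_pow_six h1 h2 hcard (u + (2 : ℝ) • v)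
  have hm2 := sum_inner_pow_six h1 h2 hcard (u - (2 : ℝ) • v)
  have h6u := sum_inner_pow_six_unit h1 h2 hcard hu
  have h6v := sum_inner_pow_six_unit h1 h2 hcard hv
  have hnp : ‖u + v‖ ^ 6 = 8 := by
    have : ‖u + v‖ ^ 2 = 2 := by rw [norm_add_sq_real, hu, hv, huv]; norm_num
    calc ‖u + v‖ ^ 6 = (‖u + v‖ ^ 2) ^ 3 := by ring
      _ = 8 := by rw [this]; norm_num
  have hnm : ‖u - v‖ ^ 6 = 8 := by
    have : ‖u - v‖ ^ 2 = 2 := by rw [norm_sub_sq_real, hu, hv, huv]; norm_num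
    calc ‖u - v‖ ^ 6 = (‖u - v‖ ^ 2) ^ 3 := by ring
      _ = 8 := by rw [this]; norm_num
  have hv2 : ‖(2 : ℝ) • v‖ = 2 := by rw [norm_smul, hv, mul_one]; norm_num
  have huv2 : inner ℝ u ((2 : ℝ) • v) = 0 := by rw [inner_smul_right, huv, mul_zero]
  have hnp2 : ‖u + (2 : ℝ) • v‖ ^ 6 = 125 := by
    have : ‖u + (2 : ℝ) • v‖ ^ 2 = 5 := by rw [norm_add_sq_real, hu, hv2, huv2]; norm_num
    calc ‖u + (2 : ℝ) • v‖ ^ 6 = (‖u + (2 : ℝ) • v‖ ^ 2) ^ 3 := by ring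
      _ = 125 := by rw [this]; norm_num
  have hnm2 : ‖u - (2 : ℝ) • v‖ ^ 6 = 125 := by
    have : ‖u - (2 : ℝ) • v‖ ^ 2 = 5 := by rw [norm_sub_sq_real, hu, hv2, huv2]; norm_num
    calc ‖u - (2 : ℝ) • v‖ ^ 6 = (‖u - (2 : ℝ) • v‖ ^ 2) ^ 3 := by ring
      _ = 125 := by rw [this]; norm_num
  rw [hnp] at hp
  rw [hnm] at hm
  rw [hnp2] at hp2
  rw [hnm2] at hm2
  simp only [inner_add_left, inner_sub_left, inner_smul_left, RCLike.conj_to_real] at hp hm hp2 hm2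
  have key1 : ∑ y ∈ C, ((inner ℝ u y + inner ℝ v y) ^ 6 + (inner ℝ u y - inner ℝ v y) ^ 6) =
      ∑ y ∈ C, (2 * inner ℝ u y ^ 6 + 30 * (inner ℝ u y ^ 4 * inner ℝ v y ^ 2) +
        30 * (inner ℝ u y ^ 2 * inner ℝ v y ^ 4) + 2 * inner ℝ v y ^ 6) :=
    Finset.sum_congr rfl fun y _ => by ring
  have key2 : ∑ y ∈ C, ((inner ℝ u y + 2 * inner ℝ v y) ^ 6 + (inner ℝ u y - 2 * inner ℝ v y) ^ 6) =
      ∑ y ∈ C, (2 * inner ℝ u y ^ 6 + 120 * (inner ℝ u y ^ 4 * inner ℝ v y ^ 2) +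
        480 * (inner ℝ u y ^ 2 * inner ℝ v y ^ 4) + 128 * inner ℝ v y ^ 6) :=
    Finset.sum_congr rfl fun y _ => by ring
  rw [Finset.sum_add_distrib, hp, hm] at key1
  rw [Finset.sum_add_distrib, hp2, hm2] at key2
  simp only [Finset.sum_add_distrib, ← Finset.mul_sum, h6u, h6v] at key1 key2
  linarith

/-- **Polarised sixth moment, three directions**: `Σ_{y ∈ C} ⟨u,y⟩²⟨v,y⟩²⟨w,y⟩² = 1/4` for orthonormal
`u, v, w` (`= 240 · ∫_{S⁷} x₁²x₂²x₃²`). -/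
theorem sum_sq_mul_sq_mul_sq {u v w : EuclideanSpace ℝ (Fin 8)} (hu : ‖u‖ = 1) (hv : ‖v‖ = 1)
    (hw : ‖w‖ = 1) (huv : inner ℝ u v = 0) (huw : inner ℝ u w = 0) (hvw : inner ℝ v w = 0) :
    ∑ y ∈ C, inner ℝ u y ^ 2 * inner ℝ v y ^ 2 * inner ℝ w y ^ 2 = 1 / 4 := by
  have e1 := sum_inner_pow_six h1 h2 hcard (u + v + w)
  have e2 := sum_inner_pow_six h1 h2 hcard (u + v - w)
  have e3 := sum_inner_pow_six h1 h2 hcard (u - v + w)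
  have e4 := sum_inner_pow_six h1 h2 hcard (u - v - w)
  have h6u := sum_inner_pow_six_unit h1 h2 hcard hu
  have h6v := sum_inner_pow_six_unit h1 h2 hcard hv
  have h6w := sum_inner_pow_six_unit h1 h2 hcard hw
  have a1 := sum_pow_four_mul_sq h1 h2 hcard hu hv huv
  have a2 := sum_pow_four_mul_sq h1 h2 hcard hv hu (by rw [real_inner_comm]; exact huv)
  have a3 := sum_pow_four_mul_sq h1 h2 hcard hu hw huw
  have a4 := sum_pow_four_mul_sq h1 h2 hcard hw hu (by rw [real_inner_comm]; exact huw)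
  have a5 := sum_pow_four_mul_sq h1 h2 hcard hv hw hvw
  have a6 := sum_pow_four_mul_sq h1 h2 hcard hw hv (by rw [real_inner_comm]; exact hvw)
  have hvu : inner ℝ v u = 0 := by rw [real_inner_comm]; exact huv
  have hwu : inner ℝ w u = 0 := by rw [real_inner_comm]; exact huw
  have hwv : inner ℝ w v = 0 := by rw [real_inner_comm]; exact hvw
  have n1 : ‖u + v + w‖ ^ 6 = 27 := by
    have : ‖u + v + w‖ ^ 2 = 3 := by
      rw [norm_add_sq_real, norm_add_sq_real, inner_add_left, hu, hv, hw, huv, huw, hvw]; norm_num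
    calc ‖u + v + w‖ ^ 6 = (‖u + v + w‖ ^ 2) ^ 3 := by ring
      _ = 27 := by rw [this]; norm_num
  have n2 : ‖u + v - w‖ ^ 6 = 27 := by
    have : ‖u + v - w‖ ^ 2 = 3 := by
      rw [norm_sub_sq_real, norm_add_sq_real, inner_add_left, hu, hv, hw, huv, huw, hvw]; norm_num
    calc ‖u + v - w‖ ^ 6 = (‖u + v - w‖ ^ 2) ^ 3 := by ring
      _ = 27 := by rw [this]; norm_num
  have n3 : ‖u - v + w‖ ^ 6 = 27 := by
    have : ‖u - v + w‖ ^ 2 = 3 := by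
      rw [norm_add_sq_real, norm_sub_sq_real, inner_sub_left, hu, hv, hw, huv, huw, hvw]; norm_num
    calc ‖u - v + w‖ ^ 6 = (‖u - v + w‖ ^ 2) ^ 3 := by ring
      _ = 27 := by rw [this]; norm_num
  have n4 : ‖u - v - w‖ ^ 6 = 27 := by
    have : ‖u - v - w‖ ^ 2 = 3 := by
      rw [norm_sub_sq_real, norm_sub_sq_real, inner_sub_left, hu, hv, hw, huv, huw, hvw]; norm_num
    calc ‖u - v - w‖ ^ 6 = (‖u - v - w‖ ^ 2) ^ 3 := by ring
      _ = 27 := by rw [this]; norm_num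
  rw [n1] at e1; rw [n2] at e2; rw [n3] at e3; rw [n4] at e4
  simp only [inner_add_left, inner_sub_left] at e1 e2 e3 e4
  have key : ∑ y ∈ C, ((inner ℝ u y + inner ℝ v y + inner ℝ w y) ^ 6 +
      (inner ℝ u y + inner ℝ v y - inner ℝ w y) ^ 6 + (inner ℝ u y - inner ℝ v y + inner ℝ w y) ^ 6 +
      (inner ℝ u y - inner ℝ v y - inner ℝ w y) ^ 6) =
      ∑ y ∈ C, (4 * inner ℝ u y ^ 6 + 4 * inner ℝ v y ^ 6 + 4 * inner ℝ w y ^ 6 +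
        60 * (inner ℝ u y ^ 4 * inner ℝ v y ^ 2) + 60 * (inner ℝ v y ^ 4 * inner ℝ u y ^ 2) +
        60 * (inner ℝ u y ^ 4 * inner ℝ w y ^ 2) + 60 * (inner ℝ w y ^ 4 * inner ℝ u y ^ 2) +
        60 * (inner ℝ v y ^ 4 * inner ℝ w y ^ 2) + 60 * (inner ℝ w y ^ 4 * inner ℝ v y ^ 2) +
        360 * (inner ℝ u y ^ 2 * inner ℝ v y ^ 2 * inner ℝ w y ^ 2)) :=
    Finset.sum_congr rfl fun y _ => by ring
  rw [Finset.sum_add_distrib, Finset.sum_add_distrib, Finset.sum_add_distrib, e1, e2, e3, e4] at key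
  simp only [Finset.sum_add_distrib, ← Finset.mul_sum, h6u, h6v, h6w, a1, a2, a3, a4, a5, a6] at key
  linarith

end config

end Summit.Ventures.PackingBounds.Config.E8Moments
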